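import Summits.Ventures.YMGap.RobustBall.CentreTwist
import HarnessLib

/-!
# RobustBall/ZNGaugeGeometry — torus bookkeeping for the layer analysis of the induced `ℤ_N` gauge theory:
# which plaquettes read which `i`-links, how many, and the transverse distance profile

HONEST FRAMING: venture file of the cell `pub-ymgap` (track Y2 ROBUST-BALL, seat ds-4 g7); finite
combinatorics on the discrete torus `(ℤ/L)^d` only — no measure, no expectation, no area law here; nothing
about the continuum limit or a Clay-sense mass gap anywhere on this track.

Fix a direction `i` (the direction of the `R` side of the Wilson loop).  The `i`-directed links `(y, i)`
are indexed by their base point `y : Site d L`; all other links are «transverse».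
* `glue i kI kT` / `splitEquiv i` — a configuration `links → ℤ/N` is the same as a pair (values on
  `i`-links `kI : Site d L → ℤ/N`, values on transverse links `kT`); sums over configurations split.
* `iSites i p` — the (at most two) base points of the `i`-links among the four links of the plaquette `p`;
  the discrete curl `plaqSum (glue i kI kT) p` reads `kI` only there (`plaqSum_glue_congr`), both with
  opposite signs (`plaqSum_glue_add_const`: a constant shift of all `i`-links does not change any curl).
* `card_filter_mem_iSites_le` — at most `2(d−1)` plaquettes read a given `i`-link (the plaquettes
  `nbPlaq i y (m, ±)`, `m ≠ i`); two `i`-sites read by one plaquette differ by `± e_m`, `m ≠ i`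
  (`eq_or_eq_of_mem_iSites`).
* `jDist j t y = |y_j − t_j|_{ℤ/L}` — the transverse distance profile in the decay direction `j`; it is
  `1`-Lipschitz along `± e_m` (`jDist_shift_le`, `jDist_le_shift`) and equals `T` between the two `i`-links
  of one rung of an `R × T` rectangle when `2T ≤ L` (`jDist_rung`).
-/

noncomputable section

open Finset Function
open Literature.MathematicalPhysics.QuantumFieldTheory

namespace Summit.Ventures.YMGap.RobustBall

namespace ZN

variable {d L N : ℕ} {S : Type*}

/-! ### Splitting a configuration into `i`-links and transverse links -/

/-- Transverse configurations: values on the links of direction `≠ i`. [folklore] -/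
abbrev Transverse (d L : ℕ) (S : Type*) (i : Fin d) : Type _ := {e : Edge d L // e.2 ≠ i} → S

/-- Glue values on `i`-links (indexed by base point) with values on transverse links. [folklore] -/
def glue (i : Fin d) (kI : Site d L → S) (kT : Transverse d L S i) : Edge d L → S :=
  fun e => if h : e.2 = i then kI e.1 else kT ⟨e, h⟩

/-- `glue` on an `i`-link. [folklore] -/
@[simp] theorem glue_apply_site (i : Fin d) (kI : Site d L → S) (kT : Transverse d L S i) (y : Site d L) :
    glue i kI kT (y, i) = kI y := by simp [glue]

/-- `glue` on a link of direction `i`. [folklore] -/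
theorem glue_apply_of_eq {i : Fin d} (kI : Site d L → S) (kT : Transverse d L S i) {e : Edge d L} (h : e.2 = i) :
    glue i kI kT e = kI e.1 := by simp [glue, h]

/-- `glue` on a transverse link. [folklore] -/
theorem glue_apply_of_ne {i : Fin d} (kI : Site d L → S) (kT : Transverse d L S i) {e : Edge d L} (h : e.2 ≠ i) :
    glue i kI kT e = kT ⟨e, h⟩ := by simp [glue, h]

/-- A configuration on all links is a pair (`i`-link values, transverse values). [folklore] -/
def splitEquiv (i : Fin d) : (Edge d L → S) ≃ (Site d L → S) × Transverse d L S i where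
  toFun k := (fun y => k (y, i), fun e => k e.1)
  invFun q := glue i q.1 q.2
  left_inv k := by
    funext e
    show glue i (fun y => k (y, i)) (fun e' => k e'.1) e = k e
    by_cases h : e.2 = i
    · rw [glue_apply_of_eq _ _ h]
      show k (e.1, i) = k e
      rw [show ((e.1, i) : Edge d L) = e from Prod.ext rfl h.symm]
    · rw [glue_apply_of_ne _ _ h]
  right_inv q := by
    obtain ⟨kI, kT⟩ := q
    refine Prod.ext (funext fun y => glue_apply_site i kI kT y) (funext fun e => ?_)
    show glue i kI kT e.1 = kT e
    rw [glue_apply_of_ne _ _ e.2]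

/-- **Sums over all configurations split** into transverse and `i`-link sums. [folklore] -/
theorem sum_eq_sum_sum_glue [Fintype S] [NeZero L] {M : Type*} [AddCommMonoid M] (i : Fin d)
    (Φ : (Edge d L → S) → M) :
    ∑ k, Φ k = ∑ kT : Transverse d L S i, ∑ kI : Site d L → S, Φ (glue i kI kT) := by
  rw [← (splitEquiv (S := S) i).symm.sum_comp, Fintype.sum_prod_type, Finset.sum_comm]
  rfl

/-! ### Which `i`-links a plaquette reads -/

/-- The base points of the `i`-links among the four links of the plaquette `p = (z; a < b)`:
`{z, z+e_b}` if `a = i`, `{z+e_a, z}` if `b = i`, none otherwise. [folklore] -/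
def iSites (i : Fin d) (p : Plaquette d L) : Finset (Site d L) :=
  if p.2.1.1 = i then {p.1, p.1.shift p.2.1.2} else if p.2.1.2 = i then {p.1.shift p.2.1.1, p.1} else ∅

/-- A plaquette reads at most two `i`-links. [folklore] -/
theorem card_iSites_le (i : Fin d) (p : Plaquette d L) : (iSites i p).card ≤ 2 := by
  unfold iSites
  split_ifs
  · exact Finset.card_le_two
  · exact Finset.card_le_two
  · simp

/-- **The discrete curl through `glue` reads `kI` only on `iSites`**: if `kI, kI'` agree on `iSites i p`
then the curls agree. [folklore] -/
theorem plaqSum_glue_congr [NeZero N] (i : Fin d) {kI kI' : Site d L → ZMod N} (kT : Transverse d L (ZMod N) i)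
    (p : Plaquette d L) (h : ∀ y ∈ iSites i p, kI y = kI' y) :
    plaqSum (glue i kI kT) p.1 p.2.1.1 p.2.1.2 = plaqSum (glue i kI' kT) p.1 p.2.1.1 p.2.1.2 := by
  obtain ⟨z, ⟨⟨a, b⟩, hab⟩⟩ := p
  have hab' : a < b := hab
  simp only [iSites] at h
  simp only [plaqSum, glue]
  by_cases ha : a = i
  · subst ha
    have hb : b ≠ a := fun hba => lt_irrefl a (by rw [hba] at hab'; exact hab')
    simp only [if_true] at h
    simp only [dif_pos, dif_neg hb, h z (by simp), h (z.shift b) (by simp)]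
  · by_cases hb : b = i
    · subst hb
      simp only [ha, if_false, if_true] at h
      simp only [dif_neg ha, dif_pos, h (z.shift a) (by simp), h z (by simp)]
    · simp only [dif_neg ha, dif_neg hb]

/-- **A constant shift of all `i`-links changes no curl** (every plaquette reads its two `i`-links with
opposite signs). [folklore] -/
theorem plaqSum_glue_add_const [NeZero N] (i : Fin d) (kI : Site d L → ZMod N) (kT : Transverse d L (ZMod N) i)
    (c : ZMod N) (p : Plaquette d L) :
    plaqSum (glue i (fun y => kI y + c) kT) p.1 p.2.1.1 p.2.1.2 = plaqSum (glue i kI kT) p.1 p.2.1.1 p.2.1.2 := by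
  obtain ⟨z, ⟨⟨a, b⟩, hab⟩⟩ := p
  have hab' : a < b := hab
  simp only [plaqSum, glue]
  by_cases ha : a = i
  · subst ha
    have hb : b ≠ a := fun hba => lt_irrefl a (by rw [hba] at hab'; exact hab')
    simp only [dif_pos, dif_neg hb]; ring
  · by_cases hb : b = i
    · subst hb
      simp only [dif_neg ha, dif_pos]; ring
    · simp only [dif_neg ha, dif_neg hb]

/-- Two `i`-sites read by the same plaquette: either equal or they differ by a unit step `± e_m`, `m ≠ i`. [folklore] -/
theorem eq_or_eq_of_mem_iSites (i : Fin d) (p : Plaquette d L) {y y' : Site d L} (hy : y ∈ iSites i p)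
    (hy' : y' ∈ iSites i p) :
    y' = y ∨ ∃ m : Fin d, m ≠ i ∧ (y' = y.shift m ∨ y = y'.shift m) := by
  obtain ⟨z, ⟨⟨a, b⟩, hab⟩⟩ := p
  have hab' : a < b := hab
  simp only [iSites] at hy hy'
  by_cases ha : a = i
  · simp only [ha, if_true, Finset.mem_insert, Finset.mem_singleton] at hy hy'
    have hb : b ≠ i := fun hbi => lt_irrefl i (by rw [ha, hbi] at hab'; exact hab')
    rcases hy with rfl | rfl <;> rcases hy' with rfl | rfl
    · exact Or.inl rfl
    · exact Or.inr ⟨b, hb, Or.inl rfl⟩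
    · exact Or.inr ⟨b, hb, Or.inr rfl⟩
    · exact Or.inl rfl
  · by_cases hb : b = i
    · simp only [ha, hb, if_false, if_true, Finset.mem_insert, Finset.mem_singleton] at hy hy'
      have ha' : a ≠ i := ha
      rcases hy with rfl | rfl <;> rcases hy' with rfl | rfl
      · exact Or.inl rfl
      · exact Or.inr ⟨a, ha', Or.inr rfl⟩
      · exact Or.inr ⟨a, ha', Or.inl rfl⟩
      · exact Or.inl rfl
    · simp [ha, hb] at hy

/-! ### At most `2(d−1)` plaquettes read a given `i`-link -/

/-- The coordinate plane spanned by `i` and `m ≠ i`, as an ordered pair. [folklore] -/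
def planeOf (i m : Fin d) (h : m ≠ i) : {q : Fin d × Fin d // q.1 < q.2} :=
  if him : i < m then ⟨(i, m), him⟩ else ⟨(m, i), lt_of_le_of_ne (not_lt.1 him) h⟩

/-- The `2(d−1)` plaquettes through the `i`-link at `y`: in the plane `{i, m}`, based at `y` or at `y − e_m`. [folklore] -/
def nbPlaq (i : Fin d) (y : Site d L) : {m : Fin d // m ≠ i} × Bool → Plaquette d L
  | (m, true) => (y, planeOf i m.1 m.2)
  | (m, false) => (y - Pi.single m.1 1, planeOf i m.1 m.2)

/-- Every plaquette reading the `i`-link at `y` is one of the `nbPlaq i y`. [folklore] -/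
theorem mem_image_nbPlaq_of_mem_iSites [NeZero L] (i : Fin d) (y : Site d L) {p : Plaquette d L}
    (hp : y ∈ iSites i p) : p ∈ Finset.univ.image (nbPlaq i y) := by
  obtain ⟨z, ⟨⟨a, b⟩, hab⟩⟩ := p
  have hab' : a < b := hab
  simp only [iSites] at hp
  rw [Finset.mem_image]
  by_cases ha : a = i
  · subst ha
    have hb : b ≠ a := fun hba => lt_irrefl a (by rw [hba] at hab'; exact hab')
    have hplane : planeOf a b hb = ⟨(a, b), hab⟩ := by simp [planeOf, hab']
    simp only [if_true, Finset.mem_insert, Finset.mem_singleton] at hp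
    rcases hp with rfl | rfl
    · exact ⟨(⟨b, hb⟩, true), Finset.mem_univ _, by simp [nbPlaq, hplane]⟩
    · refine ⟨(⟨b, hb⟩, false), Finset.mem_univ _, ?_⟩
      simp only [nbPlaq, hplane, Site.shift, add_sub_cancel_right]
  · by_cases hb : b = i
    · subst hb
      have hplane : planeOf b a ha = ⟨(a, b), hab⟩ := by
        simp [planeOf, not_lt.2 hab'.le]
      simp only [ha, if_false, if_true, Finset.mem_insert, Finset.mem_singleton] at hp
      rcases hp with rfl | rfl
      · refine ⟨(⟨a, ha⟩, false), Finset.mem_univ _, ?_⟩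
        simp only [nbPlaq, hplane, Site.shift, add_sub_cancel_right]
      · exact ⟨(⟨a, ha⟩, true), Finset.mem_univ _, by simp [nbPlaq, hplane]⟩
    · simp [ha, hb] at hp

/-- **At most `2(d−1)` plaquettes read a given `i`-link.** [folklore] -/
theorem card_filter_mem_iSites_le [NeZero L] (i : Fin d) (y : Site d L) :
    ((Finset.univ : Finset (Plaquette d L)).filter fun p => y ∈ iSites i p).card ≤ 2 * (d - 1) := by
  calc ((Finset.univ : Finset (Plaquette d L)).filter fun p => y ∈ iSites i p).card
      ≤ (Finset.univ.image (nbPlaq i y)).card :=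
        Finset.card_le_card fun p hp => mem_image_nbPlaq_of_mem_iSites i y (Finset.mem_filter.1 hp).2
    _ ≤ (Finset.univ : Finset ({m : Fin d // m ≠ i} × Bool)).card := Finset.card_image_le
    _ = 2 * (d - 1) := by
        rw [Finset.card_univ, Fintype.card_prod, Fintype.card_bool, Fintype.card_subtype_compl,
          Fintype.card_fin, Fintype.card_subtype_eq]
        omega

/-! ### The transverse distance profile in the decay direction `j` -/

/-- `|a|_{ℤ/L} ≤ val a`. [folklore] -/
theorem natAbs_valMinAbs_le_val [NeZero L] (a : ZMod L) : a.valMinAbs.natAbs ≤ a.val := by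
  rw [ZMod.valMinAbs_natAbs_eq_min]; exact min_le_left _ _

/-- `|1|_{ℤ/L} ≤ 1`. [folklore] -/
theorem natAbs_valMinAbs_one_le [NeZero L] : (1 : ZMod L).valMinAbs.natAbs ≤ 1 :=
  (natAbs_valMinAbs_le_val 1).trans (by rw [ZMod.val_one_eq_one_mod]; exact Nat.mod_le 1 L)

/-- `|a + 1|_{ℤ/L} ≤ |a|_{ℤ/L} + 1`. [folklore] -/
theorem natAbs_valMinAbs_add_one_le [NeZero L] (a : ZMod L) :
    (a + 1).valMinAbs.natAbs ≤ a.valMinAbs.natAbs + 1 :=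
  (ZMod.natAbs_valMinAbs_add_le a 1).trans ((Int.natAbs_add_le _ _).trans
    (Nat.add_le_add_left natAbs_valMinAbs_one_le _))

/-- `|a − 1|_{ℤ/L} ≤ |a|_{ℤ/L} + 1`. [folklore] -/
theorem natAbs_valMinAbs_sub_one_le [NeZero L] (a : ZMod L) :
    (a - 1).valMinAbs.natAbs ≤ a.valMinAbs.natAbs + 1 := by
  have h := ZMod.natAbs_valMinAbs_add_le a (-1)
  rw [← sub_eq_add_neg] at h
  refine h.trans ((Int.natAbs_add_le _ _).trans (Nat.add_le_add_left ?_ _))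
  rw [ZMod.natAbs_valMinAbs_neg]; exact natAbs_valMinAbs_one_le

/-- The transverse distance profile: torus distance of the `j`-coordinates to the conditioned site `t`. [folklore] -/
def jDist (j : Fin d) (t y : Site d L) : ℕ := (y j - t j).valMinAbs.natAbs

/-- `jDist j t t = 0`. [folklore] -/
@[simp] theorem jDist_self (j : Fin d) (t : Site d L) : jDist j t t = 0 := by simp [jDist]

/-- The profile grows by at most `1` along a unit step. [folklore] -/
theorem jDist_shift_le [NeZero L] (j : Fin d) (t y : Site d L) (m : Fin d) :
    jDist j t (y.shift m) ≤ jDist j t y + 1 := by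
  unfold jDist Site.shift
  by_cases hm : m = j
  · subst hm
    rw [Pi.add_apply, Pi.single_eq_same, show y m + 1 - t m = (y m - t m) + 1 by ring]
    exact natAbs_valMinAbs_add_one_le _
  · rw [Pi.add_apply, Pi.single_eq_of_ne (Ne.symm hm), add_zero]
    exact Nat.le_succ _

/-- The profile decreases by at most `1` along a unit step. [folklore] -/
theorem jDist_le_shift [NeZero L] (j : Fin d) (t y : Site d L) (m : Fin d) :
    jDist j t y ≤ jDist j t (y.shift m) + 1 := by
  unfold jDist Site.shift
  by_cases hm : m = j
  · subst hm
    rw [Pi.add_apply, Pi.single_eq_same, show y m - t m = (y m + 1 - t m) - 1 by ring]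
    exact natAbs_valMinAbs_sub_one_le _
  · rw [Pi.add_apply, Pi.single_eq_of_ne (Ne.symm hm), add_zero]
    exact Nat.le_succ _

/-- **The profile is `1`-Lipschitz between two `i`-sites read by one plaquette.** [folklore] -/
theorem jDist_le_of_mem_iSites [NeZero L] (i j : Fin d) (t : Site d L) (p : Plaquette d L) {y y' : Site d L}
    (hy : y ∈ iSites i p) (hy' : y' ∈ iSites i p) : jDist j t y ≤ jDist j t y' + 1 := by
  rcases eq_or_eq_of_mem_iSites i p hy hy' with rfl | ⟨m, -, h | h⟩
  · exact Nat.le_succ _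
  · rw [h]; exact jDist_le_shift j t y m
  · rw [h]; exact jDist_shift_le j t y' m

/-- **The two `i`-links of one rung of an `R × T` rectangle are at profile distance `T`** (when `2T ≤ L`, so
the rectangle does not wrap): bottom site `x + r e_i`, top site `x + T e_j + r e_i`, `i ≠ j`. [folklore] -/
theorem jDist_rung [NeZero L] {i j : Fin d} (hij : i ≠ j) (x : Site d L) (r T : ℕ) (hT : 2 * T ≤ L) :
    jDist j (x + Pi.single j (T : ZMod L) + Pi.single i (r : ZMod L)) (x + Pi.single i (r : ZMod L)) = T := by
  unfold jDist
  rw [Pi.add_apply, Pi.add_apply, Pi.add_apply, Pi.single_eq_same, Pi.single_eq_of_ne (Ne.symm hij),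
    show x j + 0 - (x j + (T : ZMod L) + 0) = -(T : ZMod L) by ring, ZMod.natAbs_valMinAbs_neg,
    ZMod.valMinAbs_natCast_of_le_half (by omega)]
  simp

end ZN

end Summit.Ventures.YMGap.RobustBall

end
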